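/-
Copyright (c) 2026 the pub-hodgecm-mathlib formalisation cell (harness21).  Prover seat hodgecm-mathlib-K2E3-p03 (g7), HCML Track B «K2-LIT»,
h413 = `stmt-HodgeConjecture-24833`, road (11-3-split-nsc), leaf (nsc-S-A′) `sig_K2E3GL3PrincipalBlockStandardSpan` (U12), brick (E4b-3) = the ASSEMBLY of the weak
cell lemma `h3cell` of ★ E4a for `c = ![0,0,1]` from the three `(B, P_{(2,1)})`-cell maps (dealer D106, K2 bus 2026-09-04 12:05Z; K2E3-p14 (g7)'s «NCQ dévissage»).  2026-09-04.
-/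
import Summits.HodgeConjecture.HodgeConjecture.Theorems.K2E3LeviPrincipalSeriesNoSupercuspidal          -- ★ E4b-2 ED. 2 `intertwiningMap_subrepresentation_eq_zero_of_blockMap`, §1 block data
import Summits.HodgeConjecture.HodgeConjecture.Theorems.K2E3GL3BorelInducedJacquetQFiltration           -- ★ E4b-1α filtration `exists_subrepresentation_jacquetGL_vanishingOn`, the two stable sets
import Summits.HodgeConjecture.HodgeConjecture.Theorems.K2E3GL3PrincipalSeriesConstituentsJacquetNonzero -- ★ E4a (the `h3cell` binder this file discharges the `(2,1)` half of)
import Summits.HodgeConjecture.HodgeConjecture.Theorems.K2E3GL3TwoBlockInducedIrreducibleCore           -- ★ `eq_twoOne_or_eq_oneTwo`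
import HarnessLib

/-!
# K2_E3 road (h413), leaf (nsc-S-A′), brick E4b-3 — the weak cell lemma for `P_{(2,1)} ≤ GL₃(F)`: no Levi-subrepresentation of `r_{(2,1)}(I(χ))` maps
# non-trivially to a supercuspidal representation, ASSEMBLED from the three `(B, P_{(2,1)})`-cells (NCQ dévissage)

Cell `pub/hodgecm-mathlib` (D-0151), Track B, seat K2E3-p03 (g7); dealt BY NAME by the dealer K2E3-plan (g4) (D106) on the architect K2E3-p25 (g2)'s suggestion;
architecture = K2E3-p14 (g7)'s «NCQ dévissage» (K2 bus 2026-09-04 12:00:25Z).  `--supports stmt-HodgeConjecture-24833 --as helper`; THEOREMS ONLY (no `def`, no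
instance, no notation, no named fact, no `sorry`); never imports `Cruxes/…/Lines`.  COUNT-NEUTRAL.  HYPOTHESIS-FIRST on the three cell letters `L0 ∕ L1 ∕ L2`
(bricks (E4b-1α′) K2E3-p14 (g7), (E4b-1β) K2E3-p21 (g7), (E4b-1γ) K2E5-p17 (g7)); unconditional in everything else.

THE MATHEMATICS ([BernsteinZelevinsky1977, §2.3, Thm. 2.4, Thm. 5.2 (geometric lemma)]; [Casselman1995, Cor. 5.4.3, §6.3, Prop. 6.3.1, Thm. 6.3.5]).
`G = GL₃(F)`, `B` the upper Borel, `I(χ) = Ind_B^G (χ·δ_B^{1/2})` a principal series, `P = P_{(2,1)} ⊇ B` with Levi `M ≅ GL₂(F) × GL₁(F)`, `J = r_P(I(χ))` the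
(unnormalised) Jacquet module, an `M`-representation.  CLAIM (`h3cell` of ★ E4a at `c = ![0,0,1]`): for every irreducible smooth SUPERCUSPIDAL `σ` of `M`, every
`M`-subrepresentation `N ≤ J` and every `M`-map `q : N → σ`, `q = 0`.
* The three `(B,P)` double cosets `C₀ = P` (closed) `⊆ Z := C₀ ∪ C₁ = {g ∣ g₁₀g₂₁ = g₁₁g₂₀}` (closed) `⊆ G` give the `M`-stable filtration `J ⊇ J_P ⊇ J_Z`
  (classes of functions vanishing on `P`, resp. on `Z`; ★ E4b-1α `exists_subrepresentation_jacquetGL_vanishingOn`).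
* THE CELL LETTERS.  `L0`: a `GL₂`-equivariant linear map `Ψ₀ : J → I₂(χ₀)` into a principal series of `GL₂(F)` with `ker Ψ₀ ⊆ J_P` (restriction to the closed cell);
  `L1`: on `J_P` a `GL₂`-equivariant `Ψ₁ : J_P → I₂(χ₁)` with `ker Ψ₁ ⊆ J_Z` (the middle cell integral); `L2`: on `J_Z` an INJECTIVE `GL₂`-equivariant `Ψ₂ : J_Z → I₂(χ₂)`
  (the open cell integral).  «`GL₂`-equivariant» is along a block embedding `ι : GL₂(F) → M` pinned by its block matrix `diag(g, 1)`; the letters are universally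
  quantified over such continuous `ι` and existentially over `χₖ`, `Ψₖ` (only the kernel INCLUSIONS are consumed).
* NCQ DÉVISSAGE (§1, any group `M`, any `ι : GL₂(F) → M` with `σ ∘ ι` irreducible admissible supercuspidal): write `NCQ(A)` for «every `M`-map from an
  `M`-subrepresentation `N ≤ A` to `σ` vanishes».  ★ E4b-2's relative block form of Casselman's Cor. 5.4.3 (`intertwiningMap_subrepresentation_eq_zero_of_blockMap`)
  gives: an injective cell map on `A` ⇒ `NCQ(A)` (`ncq_of_injective_cellMap`); a cell map on `A` with kernel inside `A′` and `NCQ(A′)` ⇒ `NCQ(A)` (`ncq_of_cellMap`: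
  the restriction of `q` to `N ⊓ A′` vanishes, so `q` kills `N ∩ ker Ψ`; `ncq_of_cellMap_univ` for a cell map on all of `V`).  Hence `NCQ(J_Z) ⇒ NCQ(J_P) ⇒ NCQ(J)`: **`ncq_jacquetGL_twoOne_of_cellMaps`** (§3).
* §2 `exists_continuous_blockEmbedding_twoOne`: the block embedding `ι` with its matrix, ITS CONTINUITY, and the block data of every supercuspidal `σ` (★ E4b-2 §3
  re-derived from ★ `exists_continuousMulEquiv_levi_two_one` so that continuity is exported).
* §4 glue `h3cell_of_twoOne_of_oneTwo`: the two halves `c = ![0,0,1]` (this file + the letters) and `c = ![0,1,1]` (★ E4b-T transport, K2E3-p25 (g2)) give ★ E4a's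
  binder `h3cell` VERBATIM (★ `eq_twoOne_or_eq_oneTwo`).

HONEST LABEL: HC_CM is proved only modulo the 7 printed citations (2 remaining named inputs: hLiu418 = stmt-HodgeConjecture-24832, h413 = stmt-HodgeConjecture-24833) until rung 0
closes; count-neutral helper; §3 is CONDITIONAL on the three cell letters (binders, stated not assumed as facts).

## Mathlib ∕ tree search
★ `intertwiningMap_subrepresentation_eq_zero_of_blockMap`, ★ `exists_character_blockData_of_continuousMulEquiv` (K2E3LeviPrincipalSeriesNoSupercuspidal); ★
`exists_continuousMulEquiv_levi_two_one` (K2E3GL3CuspidalBlockRestriction); ★ `exists_subrepresentation_jacquetGL_vanishingOn`, ★ `parabolic_mul_mem`, ★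
`minor_mul_eq_zero_of_mem_parabolic_twoOne` (K2E3GL3BorelInducedJacquetQFiltration); ★ `blockDiagonalGL_apply_coe_dite` (ParabolicSemidirect), ★ `leviProjection_apply_coe`; ★ `eq_twoOne_or_eq_oneTwo`
(K2E3GL3TwoBlockInducedIrreducibleCore); ★ `nonarchimedeanGroup_gl`, ★ `secondCountableTopology_gl`, ★ `locallyCompactSpace_gl`; Mathlib `Subrepresentation` lattice (`⊓`, `⊤`,
`toSubmodule_inf`), `Submodule.inclusion`, `Representation.IntertwiningMap.ext ∕ isIntertwining`, `Continuous.prodMk`.  Dedup: `rg "ncq_of_cellMap|WeakCellLemma|blockEmbedding_twoOne"`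
— only ★ E4b-2's `exists_blockEmbedding_twoOne` (no continuity; not restated: §2 adds the continuity clause and the `blockDiagonalGL` matrix form).

## References
* [BernsteinZelevinsky1977] I. N. Bernstein, A. V. Zelevinsky, *Induced representations of reductive p-adic groups I*, Ann. Sci. ÉNS 10 (1977), §2.3, Thm. 2.4, Thm. 5.2.
* [Casselman1995] W. Casselman, *Introduction to the theory of admissible representations of p-adic reductive groups* (draft 1995), Cor. 5.4.3, §6.3, Prop. 6.3.1, Thm. 6.3.5.
* [BernsteinZelevinsky1976] I. N. Bernstein, A. V. Zelevinsky, *Representations of the group GL(n,F) where F is a non-archimedean local field*, Russian Math. Surveys 31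
  (1976), §2.21–2.25, Thm. 3.21.
-/

set_option autoImplicit false
set_option linter.dupNamespace false

noncomputable section

open Function Representation
open scoped MatrixGroups
open Literature.NumberTheory.Automorphic
open Summit.HodgeConjecture.HodgeConjecture.Cruxes.H413.K2E3LeviPrincipalSeriesNoSupercuspidal
open Summit.HodgeConjecture.HodgeConjecture.Cruxes.H413.K2E3GL3BorelInducedJacquetQFiltration

namespace Summit.HodgeConjecture.HodgeConjecture.Cruxes.H413.K2E3GL3WeakCellLemma

variable {F : Type} [Field F] [ValuativeRel F] [TopologicalSpace F] [IsNonarchimedeanLocalField F]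

/-! ## §1 NCQ dévissage along cell maps into principal series of the `GL₂`-block (any `M`, any block embedding `ι`) -/

section Devissage

variable {M : Type} [Group M] {W : Type} [AddCommGroup W] [Module ℂ W]

/-- **Base of the dévissage: an INJECTIVE cell map on `A` gives `NCQ(A)`.**  `ι : GL₂(F) → M`, `σ₂ g = σ (ι g)` irreducible admissible supercuspidal; `A ≤ V` an
`M`-subrepresentation with an injective `GL₂`-equivariant linear map `Ψ : A → I₂(χ₂)` into a principal series of `GL₂(F)`; then every `M`-map `q : N → σ` from an
`M`-subrepresentation `N ≤ A` vanishes (★ E4b-2's relative block form of Casselman's Cor. 5.4.3 with the vacuous kernel condition).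
[cite: Casselman1995, Cor. 5.4.3] [cite: BernsteinZelevinsky1977, Thm. 2.4 (d)] -/
theorem ncq_of_injective_cellMap (ι : GL (Fin 2) F →* M) {σ : Representation ℂ M W}
    (σ₂ : Representation ℂ (GL (Fin 2) F) W) (hσ₂ : ∀ (g : GL (Fin 2) F) (w : W), σ₂ g w = σ (ι g) w)
    (hirr : σ₂.IsIrreducible) (hadm : σ₂.IsAdmissible) (hsc : σ₂.IsSupercuspidal)
    (χ₂ : (Π a : Fin 2, GL {i : Fin 2 // (id : Fin 2 → Fin 2) i = a} F) →* ℂˣ) {XV : Type} [AddCommGroup XV] [Module ℂ XV] (V : Representation ℂ M XV)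
    (A : Subrepresentation V)
    (Ψ : A.toSubmodule →ₗ[ℂ] SmoothInd (standardParabolicGL F (id : Fin 2 → Fin 2))
      (Representation.twist (((Representation.trivial ℂ (Π a : Fin 2, GL {i : Fin 2 // (id : Fin 2 → Fin 2) i = a} F) ℂ).twist χ₂).comp
        (leviProjection F (id : Fin 2 → Fin 2))) (rootDeltaChar (standardParabolicGL F (id : Fin 2 → Fin 2)))))
    (hΨ : ∀ (g : GL (Fin 2) F) (a : A.toSubmodule), Ψ ⟨V (ι g) (a : XV), A.apply_mem_toSubmodule (ι g) a.2⟩ =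
      (parabolicIndGL F (id : Fin 2 → Fin 2)
        ((Representation.trivial ℂ (Π a : Fin 2, GL {i : Fin 2 // (id : Fin 2 → Fin 2) i = a} F) ℂ).twist χ₂)) g (Ψ a))
    (hinj : ∀ a : A.toSubmodule, Ψ a = 0 → a = 0)
    (N : Subrepresentation V) (hNA : N.toSubmodule ≤ A.toSubmodule) (q : N.toRepresentation.IntertwiningMap σ) : q = 0 :=
  intertwiningMap_subrepresentation_eq_zero_of_blockMap ι σ₂ hσ₂ hirr hadm hsc χ₂ V A Ψ hΨ N hNA q fun x hx => by
    have h0 : (x : XV) = 0 := by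
      have := congrArg (fun a : A.toSubmodule => (a : XV)) (hinj _ hx)
      simpa using this
    have hx0 : x = 0 := Subtype.ext h0
    rw [hx0, map_zero]

/-- **The dévissage step: a cell map on `A` with kernel inside `A′`, and `NCQ(A′)`, give `NCQ(A)`.**  `ι`, `σ₂ = σ ∘ ι` as above; `A, A′ ≤ V` `M`-subrepresentations,
`Ψ : A → I₂(χ₂)` `GL₂`-equivariant with `Ψ a = 0 ⇒ a ∈ A′`; if every `M`-map from an `M`-subrepresentation of `A′` to `σ` vanishes, then so does every `M`-map `q`
from an `M`-subrepresentation `N ≤ A`: the restriction of `q` to `N ⊓ A′` vanishes, so `q` kills `N ∩ ker Ψ`, and ★ E4b-2's relative block form of Casselman's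
Cor. 5.4.3 applies. [cite: Casselman1995, Cor. 5.4.3, §6.3] [cite: BernsteinZelevinsky1977, §2.3, Thm. 2.4 (d)] -/
theorem ncq_of_cellMap (ι : GL (Fin 2) F →* M) {σ : Representation ℂ M W}
    (σ₂ : Representation ℂ (GL (Fin 2) F) W) (hσ₂ : ∀ (g : GL (Fin 2) F) (w : W), σ₂ g w = σ (ι g) w)
    (hirr : σ₂.IsIrreducible) (hadm : σ₂.IsAdmissible) (hsc : σ₂.IsSupercuspidal)
    (χ₂ : (Π a : Fin 2, GL {i : Fin 2 // (id : Fin 2 → Fin 2) i = a} F) →* ℂˣ) {XV : Type} [AddCommGroup XV] [Module ℂ XV] (V : Representation ℂ M XV)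
    (A A' : Subrepresentation V)
    (Ψ : A.toSubmodule →ₗ[ℂ] SmoothInd (standardParabolicGL F (id : Fin 2 → Fin 2))
      (Representation.twist (((Representation.trivial ℂ (Π a : Fin 2, GL {i : Fin 2 // (id : Fin 2 → Fin 2) i = a} F) ℂ).twist χ₂).comp
        (leviProjection F (id : Fin 2 → Fin 2))) (rootDeltaChar (standardParabolicGL F (id : Fin 2 → Fin 2)))))
    (hΨ : ∀ (g : GL (Fin 2) F) (a : A.toSubmodule), Ψ ⟨V (ι g) (a : XV), A.apply_mem_toSubmodule (ι g) a.2⟩ =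
      (parabolicIndGL F (id : Fin 2 → Fin 2)
        ((Representation.trivial ℂ (Π a : Fin 2, GL {i : Fin 2 // (id : Fin 2 → Fin 2) i = a} F) ℂ).twist χ₂)) g (Ψ a))
    (hker : ∀ a : A.toSubmodule, Ψ a = 0 → (a : XV) ∈ A')
    (hA' : ∀ (N' : Subrepresentation V), N'.toSubmodule ≤ A'.toSubmodule → ∀ q' : N'.toRepresentation.IntertwiningMap σ, q' = 0)
    (N : Subrepresentation V) (hNA : N.toSubmodule ≤ A.toSubmodule) (q : N.toRepresentation.IntertwiningMap σ) : q = 0 := by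
  refine intertwiningMap_subrepresentation_eq_zero_of_blockMap ι σ₂ hσ₂ hirr hadm hsc χ₂ V A Ψ hΨ N hNA q fun x hx => ?_
  -- `x ∈ N ⊓ A′`, and `q` restricted to `N ⊓ A′` vanishes by `NCQ(A′)`
  have hxA' : (x : XV) ∈ A'.toSubmodule := hker _ hx
  have hle : (N ⊓ A').toSubmodule ≤ N.toSubmodule := fun y hy => (Submodule.mem_inf.1 hy).1
  let q' : (N ⊓ A').toRepresentation.IntertwiningMap σ :=
    { toLinearMap := q.toLinearMap ∘ₗ Submodule.inclusion hle
      isIntertwining' := fun m => LinearMap.ext fun y => by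
        have hmy : Submodule.inclusion hle ((N ⊓ A').toRepresentation m y) = N.toRepresentation m (Submodule.inclusion hle y) := rfl
        simp only [LinearMap.coe_comp, Function.comp_apply, hmy]
        exact Representation.IntertwiningMap.isIntertwining _ _ q m _ }
  have hq' : q' = 0 := hA' (N ⊓ A') (fun y hy => (Submodule.mem_inf.1 hy).2) q'
  have hxq : q x = q' ⟨(x : XV), Submodule.mem_inf.2 ⟨x.2, hxA'⟩⟩ := rfl
  have h := congrArg (fun r : (N ⊓ A').toRepresentation.IntertwiningMap σ => r ⟨(x : XV), Submodule.mem_inf.2 ⟨x.2, hxA'⟩⟩) hq'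
  rw [hxq]
  exact h

/-- **The dévissage step for a cell map defined on the whole space** (the closed cell): `Ψ : V → I₂(χ₂)` `GL₂`-equivariant with `Ψ x = 0 ⇒ x ∈ A′` and `NCQ(A′)`
give `NCQ(V)` — every `M`-map from ANY `M`-subrepresentation `N ≤ V` to `σ` vanishes (`ncq_of_cellMap` for `A = N` and `Ψ|_N`).
[cite: Casselman1995, Cor. 5.4.3, §6.3] [cite: BernsteinZelevinsky1977, §2.3, Thm. 2.4 (d)] -/
theorem ncq_of_cellMap_univ (ι : GL (Fin 2) F →* M) {σ : Representation ℂ M W}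
    (σ₂ : Representation ℂ (GL (Fin 2) F) W) (hσ₂ : ∀ (g : GL (Fin 2) F) (w : W), σ₂ g w = σ (ι g) w)
    (hirr : σ₂.IsIrreducible) (hadm : σ₂.IsAdmissible) (hsc : σ₂.IsSupercuspidal)
    (χ₂ : (Π a : Fin 2, GL {i : Fin 2 // (id : Fin 2 → Fin 2) i = a} F) →* ℂˣ) {XV : Type} [AddCommGroup XV] [Module ℂ XV] (V : Representation ℂ M XV)
    (A' : Subrepresentation V)
    (Ψ : XV →ₗ[ℂ] SmoothInd (standardParabolicGL F (id : Fin 2 → Fin 2))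
      (Representation.twist (((Representation.trivial ℂ (Π a : Fin 2, GL {i : Fin 2 // (id : Fin 2 → Fin 2) i = a} F) ℂ).twist χ₂).comp
        (leviProjection F (id : Fin 2 → Fin 2))) (rootDeltaChar (standardParabolicGL F (id : Fin 2 → Fin 2)))))
    (hΨ : ∀ (g : GL (Fin 2) F) (x : XV), Ψ (V (ι g) x) =
      (parabolicIndGL F (id : Fin 2 → Fin 2)
        ((Representation.trivial ℂ (Π a : Fin 2, GL {i : Fin 2 // (id : Fin 2 → Fin 2) i = a} F) ℂ).twist χ₂)) g (Ψ x))
    (hker : ∀ x : XV, Ψ x = 0 → x ∈ A')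
    (hA' : ∀ (N' : Subrepresentation V), N'.toSubmodule ≤ A'.toSubmodule → ∀ q' : N'.toRepresentation.IntertwiningMap σ, q' = 0)
    (N : Subrepresentation V) (q : N.toRepresentation.IntertwiningMap σ) : q = 0 :=
  ncq_of_cellMap ι σ₂ hσ₂ hirr hadm hsc χ₂ V N A' (Ψ ∘ₗ N.toSubmodule.subtype)
    (fun g a => by rw [LinearMap.comp_apply, LinearMap.comp_apply, Submodule.subtype_apply, Submodule.subtype_apply]; exact hΨ g a)
    (fun a ha => hker a (by rwa [LinearMap.comp_apply, Submodule.subtype_apply] at ha)) hA' N le_rfl q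

end Devissage

/-! ## §2 The block embedding `ι : GL₂(F) → M_{(2,1)}` with its matrix, its continuity, and the block data of supercuspidal `σ` -/

/-- **THE CONTINUOUS BLOCK EMBEDDING OF THE LEVI OF `P_{(2,1)}`.**  There is a CONTINUOUS homomorphism `ι : GL₂(F) → Π_a GL {i // ![0,0,1] i = a} F` whose block diagonal
matrix is `diag(g, 1)` (`blockDiagonalGL F ![0,0,1] (ι g) = !![g₀₀, g₀₁, 0; g₁₀, g₁₁, 0; 0, 0, 1]`), such that for every irreducible smooth supercuspidal `σ` of the Levi the
block representation `σ₂ g = σ (ι g)` is irreducible, admissible and supercuspidal (★ E4b-2 §1 along ★ `exists_continuousMulEquiv_levi_two_one`; = ★ E4b-2 §3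
`exists_blockEmbedding_twoOne` with the continuity clause and the matrix in `blockDiagonalGL` form, which the cell maps consume).
[cite: Casselman1995, Thm. 5.4.1, Cor. 5.4.3] [cite: BernsteinZelevinsky1977, §2.1] -/
theorem exists_continuous_blockEmbedding_twoOne :
    ∃ ι : GL (Fin 2) F →* (Π a, GL {i // (![0, 0, 1] : Fin 3 → Fin 2) i = a} F),
      (∀ g : GL (Fin 2) F, ((blockDiagonalGL F (![0, 0, 1] : Fin 3 → Fin 2) (ι g) : GL (Fin 3) F) : Matrix (Fin 3) (Fin 3) F) =
          !![(g : Matrix (Fin 2) (Fin 2) F) 0 0, (g : Matrix (Fin 2) (Fin 2) F) 0 1, 0;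
             (g : Matrix (Fin 2) (Fin 2) F) 1 0, (g : Matrix (Fin 2) (Fin 2) F) 1 1, 0;
             0, 0, 1]) ∧
      Continuous ι ∧
      ∀ {W : Type} [AddCommGroup W] [Module ℂ W] (σ : Representation ℂ (Π a, GL {i // (![0, 0, 1] : Fin 3 → Fin 2) i = a} F) W),
        σ.IsIrreducible → σ.IsSmooth → σ.IsSupercuspidal →
          ∃ σ₂ : Representation ℂ (GL (Fin 2) F) W, (∀ (g : GL (Fin 2) F) (w : W), σ₂ g w = σ (ι g) w) ∧
            σ₂.IsIrreducible ∧ σ₂.IsAdmissible ∧ σ₂.IsSupercuspidal := by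
  haveI : IsTopologicalRing F := inferInstance
  haveI : NonarchimedeanGroup (GL (Fin 1) F) := nonarchimedeanGroup_gl F 1
  haveI : SecondCountableTopology (GL (Fin 1) F) := K2E3GLnIntegerPointsHaarVsAddHaar.secondCountableTopology_gl
  haveI : LocallyCompactSpace (GL (Fin 1) F) := K2E3GLnIntegerPointsHaarVsAddHaar.locallyCompactSpace_gl
  obtain ⟨E, hE⟩ := K2E3GL3CuspidalBlockRestriction.exists_continuousMulEquiv_levi_two_one F
  refine ⟨E.toMonoidHom.comp (MonoidHom.inl (GL (Fin 2) F) (GL (Fin 1) F)), fun g => ?_, ?_, ?_⟩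
  · -- the block matrix of `ι g = E (g, 1) = proj m`, `m = diag(g, 1)`
    obtain ⟨m, hm, hmat⟩ := hE (g, 1)
    have hιg : (E.toMonoidHom.comp (MonoidHom.inl (GL (Fin 2) F) (GL (Fin 1) F))) g = leviProjection F (![0, 0, 1] : Fin 3 → Fin 2) m := hm
    rw [hιg]
    ext i j
    rw [blockDiagonalGL_apply_coe_dite]
    fin_cases i <;> fin_cases j <;> simp [leviProjection_apply_coe, hmat]
  · -- continuity: `ι = E ∘ (g ↦ (g, 1))`
    show Continuous fun g : GL (Fin 2) F => E ((MonoidHom.inl (GL (Fin 2) F) (GL (Fin 1) F)) g)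
    simp only [MonoidHom.inl_apply]
    exact E.continuous.comp (continuous_id.prodMk continuous_const)
  · intro W _ _ σ hirr hσ hsc
    -- `GL₁(F)` is commutative
    have hcomm : ∀ a b : GL (Fin 1) F, a * b = b * a := fun a b => by
      refine Units.ext (Matrix.ext fun i j => ?_)
      rw [Units.val_mul, Units.val_mul, Matrix.mul_apply, Matrix.mul_apply, Fintype.sum_subsingleton _ i, Fintype.sum_subsingleton _ i,
        Subsingleton.elim j i, mul_comm]
    haveI := hirr
    obtain ⟨χ, -, -, h1, h2, h3⟩ := exists_character_blockData_of_continuousMulEquiv hcomm E σ hσ hsc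
    exact ⟨_, fun g w => rfl, h1, h2, h3⟩

/-! ## §3 The weak cell lemma for `c = ![0,0,1]` from the three cell letters -/

set_option maxHeartbeats 400000 in
/-- **THE WEAK CELL LEMMA FOR `P_{(2,1)} ≤ GL₃(F)` (★ E4a's `h3cell` at `c = ![0,0,1]`), ASSEMBLED FROM THE THREE `(B, P_{(2,1)})`-CELLS.**  `χ` any character of the
diagonal torus, `I(χ) = parabolicIndGL F id (𝟙.twist χ)`, `J = r_{(2,1)}(I(χ))`; `P = P_{(2,1)}`, `Z = {g ∣ g₁₀g₂₁ − g₁₁g₂₀ = 0} ⊇ P` the two right-`P`-stable closed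
unions of cells, `J_P ⊇ J_Z` the classes of functions vanishing on them (★ E4b-1α).  LETTERS (for every continuous block embedding `ι`, `diag(ι g) = diag(g,1)`):
`h0` — a `GL₂`-equivariant `Ψ₀ : J → I₂(χ₀)` with `ker Ψ₀ ⊆ J_P` (closed cell); `h1` — on `J_P` a `GL₂`-equivariant `Ψ₁ : J_P → I₂(χ₁)` with `ker Ψ₁ ⊆ J_Z` (middle cell);
`h2` — on `J_Z` an injective `GL₂`-equivariant `Ψ₂ : J_Z → I₂(χ₂)` (open cell).  CONCLUSION: for every irreducible smooth supercuspidal `σ` of the Levi (on `W : Type`),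
every Levi-subrepresentation `N ≤ J` and every Levi-map `q : N → σ`, `q = 0` — by the dévissage `NCQ(J_Z) ⇒ NCQ(J_P) ⇒ NCQ(J)` of §1 over the block data of §2.
[cite: BernsteinZelevinsky1977, Thm. 5.2, Thm. 2.4, §2.3] [cite: Casselman1995, Cor. 5.4.3, Prop. 6.3.1, Thm. 6.3.5] -/
theorem ncq_jacquetGL_twoOne_of_cellMaps (χ : (Π a : Fin 3, GL {i : Fin 3 // (id : Fin 3 → Fin 3) i = a} F) →* ℂˣ)
    (h0 : ∀ ι : GL (Fin 2) F →* (Π a, GL {i // (![0, 0, 1] : Fin 3 → Fin 2) i = a} F),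
      (∀ g : GL (Fin 2) F, ((blockDiagonalGL F (![0, 0, 1] : Fin 3 → Fin 2) (ι g) : GL (Fin 3) F) : Matrix (Fin 3) (Fin 3) F) =
          !![(g : Matrix (Fin 2) (Fin 2) F) 0 0, (g : Matrix (Fin 2) (Fin 2) F) 0 1, 0;
             (g : Matrix (Fin 2) (Fin 2) F) 1 0, (g : Matrix (Fin 2) (Fin 2) F) 1 1, 0;
             0, 0, 1]) → Continuous ι →
      ∃ (χ₂ : (Π a : Fin 2, GL {i : Fin 2 // (id : Fin 2 → Fin 2) i = a} F) →* ℂˣ)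
        (Ψ : (restrictUnipotentGL F (![0, 0, 1] : Fin 3 → Fin 2) (parabolicIndGL F (id : Fin 3 → Fin 3)
            ((Representation.trivial ℂ (Π a : Fin 3, GL {i : Fin 3 // (id : Fin 3 → Fin 3) i = a} F) ℂ).twist χ))).Coinvariants →ₗ[ℂ]
          SmoothInd (standardParabolicGL F (id : Fin 2 → Fin 2))
            (Representation.twist (((Representation.trivial ℂ (Π a : Fin 2, GL {i : Fin 2 // (id : Fin 2 → Fin 2) i = a} F) ℂ).twist χ₂).comp
              (leviProjection F (id : Fin 2 → Fin 2))) (rootDeltaChar (standardParabolicGL F (id : Fin 2 → Fin 2))))),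
        (∀ (g : GL (Fin 2) F) (x : (restrictUnipotentGL F (![0, 0, 1] : Fin 3 → Fin 2) (parabolicIndGL F (id : Fin 3 → Fin 3)
            ((Representation.trivial ℂ (Π a : Fin 3, GL {i : Fin 3 // (id : Fin 3 → Fin 3) i = a} F) ℂ).twist χ))).Coinvariants),
          Ψ (jacquetGL F (![0, 0, 1] : Fin 3 → Fin 2) (parabolicIndGL F (id : Fin 3 → Fin 3)
            ((Representation.trivial ℂ (Π a : Fin 3, GL {i : Fin 3 // (id : Fin 3 → Fin 3) i = a} F) ℂ).twist χ)) (ι g) x) =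
          (parabolicIndGL F (id : Fin 2 → Fin 2)
            ((Representation.trivial ℂ (Π a : Fin 2, GL {i : Fin 2 // (id : Fin 2 → Fin 2) i = a} F) ℂ).twist χ₂)) g (Ψ x)) ∧
        ∀ x : (restrictUnipotentGL F (![0, 0, 1] : Fin 3 → Fin 2) (parabolicIndGL F (id : Fin 3 → Fin 3)
            ((Representation.trivial ℂ (Π a : Fin 3, GL {i : Fin 3 // (id : Fin 3 → Fin 3) i = a} F) ℂ).twist χ))).Coinvariants,
          Ψ x = 0 → ∃ f ∈ vanishingOn (standardParabolicGL F (id : Fin 3 → Fin 3))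
            (Representation.twist (((Representation.trivial ℂ (Π a : Fin 3, GL {i : Fin 3 // (id : Fin 3 → Fin 3) i = a} F) ℂ).twist χ).comp
              (leviProjection F (id : Fin 3 → Fin 3))) (rootDeltaChar (standardParabolicGL F (id : Fin 3 → Fin 3))))
            (standardParabolicGL F (![0, 0, 1] : Fin 3 → Fin 2) : Set (GL (Fin 3) F)),
            Coinvariants.mk (restrictUnipotentGL F (![0, 0, 1] : Fin 3 → Fin 2) (parabolicIndGL F (id : Fin 3 → Fin 3)
              ((Representation.trivial ℂ (Π a : Fin 3, GL {i : Fin 3 // (id : Fin 3 → Fin 3) i = a} F) ℂ).twist χ))) f = x)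
    (h1 : ∀ ι : GL (Fin 2) F →* (Π a, GL {i // (![0, 0, 1] : Fin 3 → Fin 2) i = a} F),
      (∀ g : GL (Fin 2) F, ((blockDiagonalGL F (![0, 0, 1] : Fin 3 → Fin 2) (ι g) : GL (Fin 3) F) : Matrix (Fin 3) (Fin 3) F) =
          !![(g : Matrix (Fin 2) (Fin 2) F) 0 0, (g : Matrix (Fin 2) (Fin 2) F) 0 1, 0;
             (g : Matrix (Fin 2) (Fin 2) F) 1 0, (g : Matrix (Fin 2) (Fin 2) F) 1 1, 0;
             0, 0, 1]) → Continuous ι →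
      ∀ J₁ : Subrepresentation (jacquetGL F (![0, 0, 1] : Fin 3 → Fin 2) (parabolicIndGL F (id : Fin 3 → Fin 3)
          ((Representation.trivial ℂ (Π a : Fin 3, GL {i : Fin 3 // (id : Fin 3 → Fin 3) i = a} F) ℂ).twist χ))),
        (∀ x, x ∈ J₁ ↔ ∃ f ∈ vanishingOn (standardParabolicGL F (id : Fin 3 → Fin 3))
            (Representation.twist (((Representation.trivial ℂ (Π a : Fin 3, GL {i : Fin 3 // (id : Fin 3 → Fin 3) i = a} F) ℂ).twist χ).comp
              (leviProjection F (id : Fin 3 → Fin 3))) (rootDeltaChar (standardParabolicGL F (id : Fin 3 → Fin 3))))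
            (standardParabolicGL F (![0, 0, 1] : Fin 3 → Fin 2) : Set (GL (Fin 3) F)),
            Coinvariants.mk (restrictUnipotentGL F (![0, 0, 1] : Fin 3 → Fin 2) (parabolicIndGL F (id : Fin 3 → Fin 3)
              ((Representation.trivial ℂ (Π a : Fin 3, GL {i : Fin 3 // (id : Fin 3 → Fin 3) i = a} F) ℂ).twist χ))) f = x) →
        ∃ (χ₂ : (Π a : Fin 2, GL {i : Fin 2 // (id : Fin 2 → Fin 2) i = a} F) →* ℂˣ)
          (Ψ : J₁.toSubmodule →ₗ[ℂ]
            SmoothInd (standardParabolicGL F (id : Fin 2 → Fin 2))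
              (Representation.twist (((Representation.trivial ℂ (Π a : Fin 2, GL {i : Fin 2 // (id : Fin 2 → Fin 2) i = a} F) ℂ).twist χ₂).comp
                (leviProjection F (id : Fin 2 → Fin 2))) (rootDeltaChar (standardParabolicGL F (id : Fin 2 → Fin 2))))),
          (∀ (g : GL (Fin 2) F) (a : J₁.toSubmodule),
            Ψ ⟨jacquetGL F (![0, 0, 1] : Fin 3 → Fin 2) (parabolicIndGL F (id : Fin 3 → Fin 3)
              ((Representation.trivial ℂ (Π a : Fin 3, GL {i : Fin 3 // (id : Fin 3 → Fin 3) i = a} F) ℂ).twist χ)) (ι g)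
                (a : (restrictUnipotentGL F (![0, 0, 1] : Fin 3 → Fin 2) (parabolicIndGL F (id : Fin 3 → Fin 3)
                  ((Representation.trivial ℂ (Π a : Fin 3, GL {i : Fin 3 // (id : Fin 3 → Fin 3) i = a} F) ℂ).twist χ))).Coinvariants),
              J₁.apply_mem_toSubmodule (ι g) a.2⟩ =
            (parabolicIndGL F (id : Fin 2 → Fin 2)
              ((Representation.trivial ℂ (Π a : Fin 2, GL {i : Fin 2 // (id : Fin 2 → Fin 2) i = a} F) ℂ).twist χ₂)) g (Ψ a)) ∧
          ∀ a : J₁.toSubmodule, Ψ a = 0 → ∃ f ∈ vanishingOn (standardParabolicGL F (id : Fin 3 → Fin 3))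
            (Representation.twist (((Representation.trivial ℂ (Π a : Fin 3, GL {i : Fin 3 // (id : Fin 3 → Fin 3) i = a} F) ℂ).twist χ).comp
              (leviProjection F (id : Fin 3 → Fin 3))) (rootDeltaChar (standardParabolicGL F (id : Fin 3 → Fin 3))))
            {g : GL (Fin 3) F | (g : Matrix (Fin 3) (Fin 3) F) 1 0 * (g : Matrix (Fin 3) (Fin 3) F) 2 1 -
              (g : Matrix (Fin 3) (Fin 3) F) 1 1 * (g : Matrix (Fin 3) (Fin 3) F) 2 0 = 0},
            Coinvariants.mk (restrictUnipotentGL F (![0, 0, 1] : Fin 3 → Fin 2) (parabolicIndGL F (id : Fin 3 → Fin 3)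
              ((Representation.trivial ℂ (Π a : Fin 3, GL {i : Fin 3 // (id : Fin 3 → Fin 3) i = a} F) ℂ).twist χ))) f =
              (a : (restrictUnipotentGL F (![0, 0, 1] : Fin 3 → Fin 2) (parabolicIndGL F (id : Fin 3 → Fin 3)
                ((Representation.trivial ℂ (Π a : Fin 3, GL {i : Fin 3 // (id : Fin 3 → Fin 3) i = a} F) ℂ).twist χ))).Coinvariants))
    (h2 : ∀ ι : GL (Fin 2) F →* (Π a, GL {i // (![0, 0, 1] : Fin 3 → Fin 2) i = a} F),
      (∀ g : GL (Fin 2) F, ((blockDiagonalGL F (![0, 0, 1] : Fin 3 → Fin 2) (ι g) : GL (Fin 3) F) : Matrix (Fin 3) (Fin 3) F) =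
          !![(g : Matrix (Fin 2) (Fin 2) F) 0 0, (g : Matrix (Fin 2) (Fin 2) F) 0 1, 0;
             (g : Matrix (Fin 2) (Fin 2) F) 1 0, (g : Matrix (Fin 2) (Fin 2) F) 1 1, 0;
             0, 0, 1]) → Continuous ι →
      ∀ J₂ : Subrepresentation (jacquetGL F (![0, 0, 1] : Fin 3 → Fin 2) (parabolicIndGL F (id : Fin 3 → Fin 3)
          ((Representation.trivial ℂ (Π a : Fin 3, GL {i : Fin 3 // (id : Fin 3 → Fin 3) i = a} F) ℂ).twist χ))),
        (∀ x, x ∈ J₂ ↔ ∃ f ∈ vanishingOn (standardParabolicGL F (id : Fin 3 → Fin 3))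
            (Representation.twist (((Representation.trivial ℂ (Π a : Fin 3, GL {i : Fin 3 // (id : Fin 3 → Fin 3) i = a} F) ℂ).twist χ).comp
              (leviProjection F (id : Fin 3 → Fin 3))) (rootDeltaChar (standardParabolicGL F (id : Fin 3 → Fin 3))))
            {g : GL (Fin 3) F | (g : Matrix (Fin 3) (Fin 3) F) 1 0 * (g : Matrix (Fin 3) (Fin 3) F) 2 1 -
              (g : Matrix (Fin 3) (Fin 3) F) 1 1 * (g : Matrix (Fin 3) (Fin 3) F) 2 0 = 0},
            Coinvariants.mk (restrictUnipotentGL F (![0, 0, 1] : Fin 3 → Fin 2) (parabolicIndGL F (id : Fin 3 → Fin 3)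
              ((Representation.trivial ℂ (Π a : Fin 3, GL {i : Fin 3 // (id : Fin 3 → Fin 3) i = a} F) ℂ).twist χ))) f = x) →
        ∃ (χ₂ : (Π a : Fin 2, GL {i : Fin 2 // (id : Fin 2 → Fin 2) i = a} F) →* ℂˣ)
          (Ψ : J₂.toSubmodule →ₗ[ℂ]
            SmoothInd (standardParabolicGL F (id : Fin 2 → Fin 2))
              (Representation.twist (((Representation.trivial ℂ (Π a : Fin 2, GL {i : Fin 2 // (id : Fin 2 → Fin 2) i = a} F) ℂ).twist χ₂).comp
                (leviProjection F (id : Fin 2 → Fin 2))) (rootDeltaChar (standardParabolicGL F (id : Fin 2 → Fin 2))))),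
          (∀ (g : GL (Fin 2) F) (a : J₂.toSubmodule),
            Ψ ⟨jacquetGL F (![0, 0, 1] : Fin 3 → Fin 2) (parabolicIndGL F (id : Fin 3 → Fin 3)
              ((Representation.trivial ℂ (Π a : Fin 3, GL {i : Fin 3 // (id : Fin 3 → Fin 3) i = a} F) ℂ).twist χ)) (ι g)
                (a : (restrictUnipotentGL F (![0, 0, 1] : Fin 3 → Fin 2) (parabolicIndGL F (id : Fin 3 → Fin 3)
                  ((Representation.trivial ℂ (Π a : Fin 3, GL {i : Fin 3 // (id : Fin 3 → Fin 3) i = a} F) ℂ).twist χ))).Coinvariants),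
              J₂.apply_mem_toSubmodule (ι g) a.2⟩ =
            (parabolicIndGL F (id : Fin 2 → Fin 2)
              ((Representation.trivial ℂ (Π a : Fin 2, GL {i : Fin 2 // (id : Fin 2 → Fin 2) i = a} F) ℂ).twist χ₂)) g (Ψ a)) ∧
          ∀ a : J₂.toSubmodule, Ψ a = 0 → a = 0) :
    ∀ (W : Type) [AddCommGroup W] [Module ℂ W] (σ : Representation ℂ (Π a : Fin 2, GL {i : Fin 3 // (![0, 0, 1] : Fin 3 → Fin 2) i = a} F) W),
      σ.IsIrreducible → σ.IsSmooth → σ.IsSupercuspidal →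
      ∀ (N : Subrepresentation (jacquetGL F (![0, 0, 1] : Fin 3 → Fin 2) (parabolicIndGL F (id : Fin 3 → Fin 3)
          ((Representation.trivial ℂ (Π a : Fin 3, GL {i : Fin 3 // (id : Fin 3 → Fin 3) i = a} F) ℂ).twist χ))))
        (q : N.toRepresentation.IntertwiningMap σ), q = 0 := by
  haveI : IsTopologicalRing F := inferInstance
  -- §2: the block embedding and its properties
  obtain ⟨ι, hι, hιc, hblock⟩ := exists_continuous_blockEmbedding_twoOne (F := F)
  intro W _ _ σ hirr hsm hsc N q
  obtain ⟨σ₂, hσ₂, hirr₂, hadm₂, hsc₂⟩ := hblock σ hirr hsm hsc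
  -- the filtration `J ⊇ J_P ⊇ J_Z` (★ E4b-1α); (`have` before `obtain`: destructuring the applied term directly makes `generalize` time out)
  have hJP := exists_subrepresentation_jacquetGL_vanishingOn (![0, 0, 1] : Fin 3 → Fin 2)
    (Representation.twist (((Representation.trivial ℂ (Π a : Fin 3, GL {i : Fin 3 // (id : Fin 3 → Fin 3) i = a} F) ℂ).twist χ).comp
      (leviProjection F (id : Fin 3 → Fin 3))) (rootDeltaChar (standardParabolicGL F (id : Fin 3 → Fin 3))))
    (standardParabolicGL F (![0, 0, 1] : Fin 3 → Fin 2) : Set (GL (Fin 3) F)) (parabolic_mul_mem (F := F) (![0, 0, 1] : Fin 3 → Fin 2))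
  obtain ⟨J₁, hJ₁⟩ := hJP
  have hJZ := exists_subrepresentation_jacquetGL_vanishingOn (![0, 0, 1] : Fin 3 → Fin 2)
    (Representation.twist (((Representation.trivial ℂ (Π a : Fin 3, GL {i : Fin 3 // (id : Fin 3 → Fin 3) i = a} F) ℂ).twist χ).comp
      (leviProjection F (id : Fin 3 → Fin 3))) (rootDeltaChar (standardParabolicGL F (id : Fin 3 → Fin 3))))
    {g : GL (Fin 3) F | (g : Matrix (Fin 3) (Fin 3) F) 1 0 * (g : Matrix (Fin 3) (Fin 3) F) 2 1 -
      (g : Matrix (Fin 3) (Fin 3) F) 1 1 * (g : Matrix (Fin 3) (Fin 3) F) 2 0 = 0} (minor_mul_eq_zero_of_mem_parabolic_twoOne (F := F))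
  obtain ⟨J₂, hJ₂⟩ := hJZ
  -- the three cell maps
  have hc0 := h0 ι hι hιc
  have hc1 := h1 ι hι hιc J₁ hJ₁
  have hc2 := h2 ι hι hιc J₂ hJ₂
  obtain ⟨χ₀, Ψ₀, hΨ₀, hker₀⟩ := hc0
  obtain ⟨χ₁, Ψ₁, hΨ₁, hker₁⟩ := hc1
  obtain ⟨χ₂', Ψ₂, hΨ₂, hker₂⟩ := hc2
  -- NCQ(J_Z): the open cell map is injective
  have hNCQ₂ := ncq_of_injective_cellMap ι σ₂ hσ₂ hirr₂ hadm₂ hsc₂ χ₂' _ J₂ Ψ₂ hΨ₂ hker₂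
  -- NCQ(J_P): the middle cell map has kernel inside `J_Z`
  have hNCQ₁ := ncq_of_cellMap ι σ₂ hσ₂ hirr₂ hadm₂ hsc₂ χ₁ _ J₁ J₂ Ψ₁ hΨ₁ (fun a ha => (hJ₂ _).2 (hker₁ a ha)) hNCQ₂
  -- NCQ(J): the closed cell map (on the whole Jacquet module) has kernel inside `J_P`
  exact ncq_of_cellMap_univ ι σ₂ hσ₂ hirr₂ hadm₂ hsc₂ χ₀ _ J₁ Ψ₀ hΨ₀ (fun x hx => (hJ₁ _).2 (hker₀ x hx)) hNCQ₁ N q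

/-! ## §4 Glue: the two maximal parabolics give ★ E4a's binder `h3cell` -/

/-- **★ E4a's `h3cell` FROM ITS TWO HALVES.**  A monotone surjective `c : Fin 3 → Fin 2` is `![0,0,1]` or `![0,1,1]` (★ `eq_twoOne_or_eq_oneTwo`), so the weak cell lemma
for the two maximal standard parabolics `P_{(2,1)}`, `P_{(1,2)}` (this file's §3 under its letters, resp. its transport along the outer automorphism, ★ E4b-T) IS the
hypothesis `h3cell` of ★ `nontrivial_coinvariants_of_isConstituentOf_principalSeries_three`, token for token.
[cite: BernsteinZelevinsky1977, §2.2, Thm. 2.4] [cite: Casselman1995, §6.3] -/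
theorem h3cell_of_twoOne_of_oneTwo (χ : (Π a : Fin 3, GL {i : Fin 3 // (id : Fin 3 → Fin 3) i = a} F) →* ℂˣ)
    (h₂₁ : ∀ (W : Type) [AddCommGroup W] [Module ℂ W] (σ : Representation ℂ (Π a : Fin 2, GL {i : Fin 3 // (![0, 0, 1] : Fin 3 → Fin 2) i = a} F) W),
      σ.IsIrreducible → σ.IsSmooth → σ.IsSupercuspidal →
      ∀ (N : Subrepresentation (jacquetGL F (![0, 0, 1] : Fin 3 → Fin 2) (parabolicIndGL F (id : Fin 3 → Fin 3)
          ((Representation.trivial ℂ (Π a : Fin 3, GL {i : Fin 3 // (id : Fin 3 → Fin 3) i = a} F) ℂ).twist χ))))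
        (q : N.toRepresentation.IntertwiningMap σ), q = 0)
    (h₁₂ : ∀ (W : Type) [AddCommGroup W] [Module ℂ W] (σ : Representation ℂ (Π a : Fin 2, GL {i : Fin 3 // (![0, 1, 1] : Fin 3 → Fin 2) i = a} F) W),
      σ.IsIrreducible → σ.IsSmooth → σ.IsSupercuspidal →
      ∀ (N : Subrepresentation (jacquetGL F (![0, 1, 1] : Fin 3 → Fin 2) (parabolicIndGL F (id : Fin 3 → Fin 3)
          ((Representation.trivial ℂ (Π a : Fin 3, GL {i : Fin 3 // (id : Fin 3 → Fin 3) i = a} F) ℂ).twist χ))))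
        (q : N.toRepresentation.IntertwiningMap σ), q = 0) :
    ∀ c : Fin 3 → Fin 2, Monotone c → Function.Surjective c →
      ∀ (W : Type) [AddCommGroup W] [Module ℂ W] (σ : Representation ℂ (Π a : Fin 2, GL {i : Fin 3 // c i = a} F) W),
        σ.IsIrreducible → σ.IsSmooth → σ.IsSupercuspidal →
        ∀ (N : Subrepresentation (jacquetGL F c (parabolicIndGL F (id : Fin 3 → Fin 3)
            ((Representation.trivial ℂ (Π a : Fin 3, GL {i : Fin 3 // (id : Fin 3 → Fin 3) i = a} F) ℂ).twist χ))))
          (q : N.toRepresentation.IntertwiningMap σ), q = 0 := by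
  intro c hcm hcs
  rcases K2E3GL3TwoBlockInducedIrreducibleCore.eq_twoOne_or_eq_oneTwo c hcm hcs with rfl | rfl
  · exact h₂₁
  · exact h₁₂

/-- **Sanity link to ★ E4a**: under the two halves, every constituent of the principal series `I(χ)` of `GL₃(F)` has a non-zero Borel Jacquet module
(★ `nontrivial_coinvariants_of_isConstituentOf_principalSeries_three` fed with `h3cell_of_twoOne_of_oneTwo`). [cite: BernsteinZelevinsky1977, Thm. 2.9] [cite: Casselman1995, Thm. 6.3.7] -/
theorem nontrivial_coinvariants_of_isConstituentOf_of_twoOne_of_oneTwo (χ : (Π a : Fin 3, GL {i : Fin 3 // (id : Fin 3 → Fin 3) i = a} F) →* ℂˣ)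
    (h₂₁ : ∀ (W : Type) [AddCommGroup W] [Module ℂ W] (σ : Representation ℂ (Π a : Fin 2, GL {i : Fin 3 // (![0, 0, 1] : Fin 3 → Fin 2) i = a} F) W),
      σ.IsIrreducible → σ.IsSmooth → σ.IsSupercuspidal →
      ∀ (N : Subrepresentation (jacquetGL F (![0, 0, 1] : Fin 3 → Fin 2) (parabolicIndGL F (id : Fin 3 → Fin 3)
          ((Representation.trivial ℂ (Π a : Fin 3, GL {i : Fin 3 // (id : Fin 3 → Fin 3) i = a} F) ℂ).twist χ))))
        (q : N.toRepresentation.IntertwiningMap σ), q = 0)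
    (h₁₂ : ∀ (W : Type) [AddCommGroup W] [Module ℂ W] (σ : Representation ℂ (Π a : Fin 2, GL {i : Fin 3 // (![0, 1, 1] : Fin 3 → Fin 2) i = a} F) W),
      σ.IsIrreducible → σ.IsSmooth → σ.IsSupercuspidal →
      ∀ (N : Subrepresentation (jacquetGL F (![0, 1, 1] : Fin 3 → Fin 2) (parabolicIndGL F (id : Fin 3 → Fin 3)
          ((Representation.trivial ℂ (Π a : Fin 3, GL {i : Fin 3 // (id : Fin 3 → Fin 3) i = a} F) ℂ).twist χ))))
        (q : N.toRepresentation.IntertwiningMap σ), q = 0)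
    (r : SmoothIrrep (GL (Fin 3) F))
    (hr : (IrrClass.mk r).IsConstituentOf (parabolicIndGL F (id : Fin 3 → Fin 3)
      ((Representation.trivial ℂ (Π a : Fin 3, GL {i : Fin 3 // (id : Fin 3 → Fin 3) i = a} F) ℂ).twist χ))) :
    Nontrivial (restrictUnipotentGL F (id : Fin 3 → Fin 3) r.ρ).Coinvariants :=
  K2E3GL3PrincipalSeriesConstituentsJacquetNonzero.nontrivial_coinvariants_of_isConstituentOf_principalSeries_three χ
    (h3cell_of_twoOne_of_oneTwo χ h₂₁ h₁₂) r hr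

end Summit.HodgeConjecture.HodgeConjecture.Cruxes.H413.K2E3GL3WeakCellLemma

end
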